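import Summits.CriticalPhenomena.PercolationContinuityZ3.Theorems.PercNearOneGluingNoHeavyLowerTailOneCutFiveHeavyHair
import Mathlib.Tactic.Linarith
import HarnessLib

/-!
# The product form with an edge of ARBITRARY weight: `β² · μ(B={a}) μ(B={c}) ≤ (1−β)² · μ(B={a,b}) μ(B={b,c})`

Support file for stmt-CriticalPhenomena-4575 (insurance line `Z(3,2)` = `OneCutFive.ZeroOneThree`), prover seat
`prim-ineq-gen-8` (gen 10).  No `sorry`, standard axioms, no definitions.  Quantitative companion of
`OneCutFive.productForm_of_half_le` (`…OneCutFiveHeavyHair.lean`): the same pivot on the pair `e = o–b` with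
`β = w(o,b)` arbitrary gives, for every finite weighted graph and `a ≠ c`,
`β² · μ(o↔a only) · μ(o↔c only) ≤ (1−β)² · μ(B={a,b}) · μ(B={b,c})`;
at `β ≥ ½` this is the heavy-edge product form, and for a light hair `β < ½` it bounds how badly the two pocket exchanges
at `a` and `c` can fail simultaneously: `(s_a/d_bc)·(s_c/d_ab) ≤ ((1−β)/β)²`.  (At a three-port observer the row is
implied termwise by the closed-form cells; its content is for general observers.) [this work]
-/

noncomputable section

namespace Summit.CriticalPhenomena.PercolationContinuityZ3.Theorems

open MeasureTheory Set Literature.Probability.LatticeModels Literature.Probability.Percolation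
open scoped Classical BigOperators

namespace OneCutFive

variable {V : Type*} [Fintype V]

/-- **Product form with an edge of arbitrary weight** (new): for `e = o–b` of weight `β` and `a ≠ c`,
`β² · μ(B={a}) μ(B={c}) ≤ (1−β)² · μ(B={a,b}) μ(B={b,c})`.  Proof: pivot on `e`
(`measureReal_pivot`): `μ(B={a}) = (1−β) μ₀(B={a})`, `μ(B={b,c}) ≥ β μ₀(o↔c, o↮a, b↮a)`, and the
hypothesis-free `productForm_star` for the closed-edge measure `μ₀`. [this work] -/
theorem productForm_edge_weight (w : Sym2 V → unitInterval) (o a b c : V) (hob : o ≠ b) (hac : a ≠ c) :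
    ((w s(o, b) : ℝ)) ^ 2 *
        ((prodBernoulli w).real {ω | ω ∈ openConn o a ∧ ω ∉ openConn o b ∧ ω ∉ openConn o c} *
          (prodBernoulli w).real {ω | ω ∈ openConn o c ∧ ω ∉ openConn o a ∧ ω ∉ openConn o b}) ≤
      (1 - (w s(o, b) : ℝ)) ^ 2 *
        ((prodBernoulli w).real {ω | ω ∉ openConn o c ∧ ω ∈ openConn o a ∧ ω ∈ openConn o b} *
          (prodBernoulli w).real {ω | ω ∉ openConn o a ∧ ω ∈ openConn o b ∧ ω ∈ openConn o c}) := by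
  set μ := prodBernoulli w with hμ
  set e : Sym2 V := s(o, b) with hedef
  set β : ℝ := (w e : ℝ) with hβdef
  set μ₀ := prodBernoulli (Function.update w e 0) with hμ₀
  have hmeas : ∀ T : Set (BondConfig V), MeasurableSet T := fun _ => MeasurableSet.of_discrete
  have hβ1 : β ≤ 1 := (w e).2.2
  have hβ0 : 0 ≤ β := (w e).2.1
  -- names for the cells
  set Sa : Set (BondConfig V) := {ω | ω ∈ openConn o a ∧ ω ∉ openConn o b ∧ ω ∉ openConn o c} with hSa
  set Sc : Set (BondConfig V) := {ω | ω ∈ openConn o c ∧ ω ∉ openConn o a ∧ ω ∉ openConn o b} with hSc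
  set Dab : Set (BondConfig V) := {ω | ω ∉ openConn o c ∧ ω ∈ openConn o a ∧ ω ∈ openConn o b} with hDab
  set Dbc : Set (BondConfig V) := {ω | ω ∉ openConn o a ∧ ω ∈ openConn o b ∧ ω ∈ openConn o c} with hDbc
  set Ea : Set (BondConfig V) := {ω | ω ∈ openConn o a ∧ ω ∉ openConn o c ∧ ω ∉ openConn b c} with hEa
  set Ec : Set (BondConfig V) := {ω | ω ∈ openConn o c ∧ ω ∉ openConn o a ∧ ω ∉ openConn b a} with hEc
  -- (1) with `e` open, `b ∈ B`: the singleton cells vanish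
  have hSa_ins : {η : BondConfig V | insert e η ∈ Sa} = ∅ := by
    ext η
    simp only [mem_setOf_eq, mem_empty_iff_false, iff_false, hSa, not_and, mem_openConn_iff_reachable]
    exact fun _ hnb _ => hnb (reachable_insert_self η hob)
  have hSc_ins : {η : BondConfig V | insert e η ∈ Sc} = ∅ := by
    ext η
    simp only [mem_setOf_eq, mem_empty_iff_false, iff_false, hSc, not_and, mem_openConn_iff_reachable]
    exact fun _ _ hnb => hnb (reachable_insert_self η hob)
  have hsa : μ.real Sa = (1 - β) * μ₀.real Sa := by
    have h := measureReal_pivot w e Sa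
    rw [hSa_ins, measureReal_empty, mul_zero, add_zero] at h
    exact h
  have hsc : μ.real Sc = (1 - β) * μ₀.real Sc := by
    have h := measureReal_pivot w e Sc
    rw [hSc_ins, measureReal_empty, mul_zero, add_zero] at h
    exact h
  -- (2) with `e` open, `μ₀(E_c') ≤ μ{insert e ∈ D_bc}` and `μ₀(E_a') ≤ μ{insert e ∈ D_ab}`
  have hEc_sub : {η : BondConfig V | η \ {e} ∈ Ec} ⊆ {η | insert e η ∈ Dbc} := by
    intro η hη
    simp only [mem_setOf_eq, hEc, hDbc, mem_openConn_iff_reachable] at hη ⊢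
    obtain ⟨hoc, hoa, hba⟩ := hη
    rw [← insert_sdiff_singleton]
    refine ⟨fun h => hoa ?_, reachable_insert_self _ hob, reachable_insert_mono _ _ hoc⟩
    -- `o ↔ a` after inserting `o–b` would force `a ↔ o` or `a ↔ b` before
    exact (reachable_of_reachable_insert (η \ {e}) o b a o (fun h' => hoa h'.symm)
      (fun h' => hba h'.symm) h.symm).symm
  have hEa_sub : {η : BondConfig V | η \ {e} ∈ Ea} ⊆ {η | insert e η ∈ Dab} := by
    intro η hη
    simp only [mem_setOf_eq, hEa, hDab, mem_openConn_iff_reachable] at hη ⊢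
    obtain ⟨hoa, hoc, hbc⟩ := hη
    rw [← insert_sdiff_singleton]
    refine ⟨fun h => hoc ?_, reachable_insert_mono _ _ hoa, reachable_insert_self _ hob⟩
    exact (reachable_of_reachable_insert (η \ {e}) o b c o (fun h' => hoc h'.symm)
      (fun h' => hbc h'.symm) h.symm).symm
  have htrans : ∀ T : Set (BondConfig V), μ.real {η | η \ {e} ∈ T} = μ₀.real T := by
    intro T
    have h := BHK2006.integral_comp_sdiff_prodBernoulli' w (Function.update w e 0) {e} (update_zero_of_mem w e)
      (update_zero_of_not_mem w e) (T.indicator (1 : BondConfig V → ℝ))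
    rw [integral_indicator_one (hmeas T)] at h
    have hpre : (fun η : BondConfig V => T.indicator (1 : BondConfig V → ℝ) (η \ {e})) =
        {η : BondConfig V | η \ {e} ∈ T}.indicator 1 := by
      funext η
      by_cases hη : η \ {e} ∈ T
      · rw [indicator_of_mem hη, indicator_of_mem (show η ∈ {η : BondConfig V | η \ {e} ∈ T} from hη)]
        rfl
      · rw [indicator_of_notMem hη, indicator_of_notMem (show η ∉ {η : BondConfig V | η \ {e} ∈ T} from hη)]
    rw [hpre, integral_indicator_one (hmeas _)] at h
    exact h
  have hdbc : β * μ₀.real Ec ≤ μ.real Dbc := by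
    have h := measureReal_pivot w e Dbc
    have h1 : μ₀.real Ec ≤ μ.real {η | insert e η ∈ Dbc} := by
      rw [← htrans Ec]; exact measureReal_mono hEc_sub
    have h2 : 0 ≤ (1 - β) * (prodBernoulli (Function.update w e 0)).real Dbc := mul_nonneg (by linarith) measureReal_nonneg
    rw [h]
    nlinarith
  have hdab : β * μ₀.real Ea ≤ μ.real Dab := by
    have h := measureReal_pivot w e Dab
    have h1 : μ₀.real Ea ≤ μ.real {η | insert e η ∈ Dab} := by
      rw [← htrans Ea]; exact measureReal_mono hEa_sub
    have h2 : 0 ≤ (1 - β) * (prodBernoulli (Function.update w e 0)).real Dab := mul_nonneg (by linarith) measureReal_nonneg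
    rw [h]
    nlinarith
  -- (3) the hypothesis-free product form for `μ₀`
  have hstar : μ₀.real Sa * μ₀.real Sc ≤ μ₀.real Ea * μ₀.real Ec := productForm_star (Function.update w e 0) o a b c hac
  -- (4) assemble: `(1−β)² ≤ β²`
  have hEa0 : 0 ≤ μ₀.real Ea := measureReal_nonneg
  have hEc0 : 0 ≤ μ₀.real Ec := measureReal_nonneg
  have hSa0 : 0 ≤ μ₀.real Sa := measureReal_nonneg
  have hSc0 : 0 ≤ μ₀.real Sc := measureReal_nonneg
  rw [hsa, hsc]
  have hb1 : 0 ≤ 1 - β := by linarith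
  calc β ^ 2 * ((1 - β) * μ₀.real Sa * ((1 - β) * μ₀.real Sc))
      = (β ^ 2 * (1 - β) ^ 2) * (μ₀.real Sa * μ₀.real Sc) := by ring
    _ ≤ (β ^ 2 * (1 - β) ^ 2) * (μ₀.real Ea * μ₀.real Ec) :=
        mul_le_mul_of_nonneg_left hstar (mul_nonneg (sq_nonneg _) (sq_nonneg _))
    _ = (1 - β) ^ 2 * ((β * μ₀.real Ea) * (β * μ₀.real Ec)) := by ring
    _ ≤ (1 - β) ^ 2 * (μ.real Dab * μ.real Dbc) :=
        mul_le_mul_of_nonneg_left (mul_le_mul hdab hdbc (mul_nonneg hβ0 hEc0) measureReal_nonneg) (sq_nonneg _)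

end OneCutFive

end Summit.CriticalPhenomena.PercolationContinuityZ3.Theorems

end
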